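import Literature.Barriers.CriticalPhenomena.PlaquetteWalkHoleRootSealedPocket
import HarnessLib

/-!
# Barrier catalogue (SAWScalingLimit): THE PORT TRIPLES AND THE SEALED POCKETS IN BOXES — five identically-vanishing configurations
of the hole-root vertex functional in every box, any further defects

Leaf of `PlaquetteWalkHoleRootSealedPocket` (cone: `PlaquetteWalkHoleRootSealedDoors` — `ΩG.WE_eq_excursionWinding_of_farSW/farNW/farWW_deadEnd`,
`ΩG.false_of_rootSealed`; `…SealedPocket` — `…_of_farSW/farNW_pocket2`; box vocabulary `boxMinus` of `PlaquetteWalkHoleRootLawLBoxes`).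
Setting: the `m × n` box minus a cell list `S ∋ h`, hole `h`, root plaquette `(h.1 + 1, h.2)` rooted at `W`, far cell `(h.1 − 1, h.2)` kept.

The four PORT TRIPLES excluded by the lane's «ANY TRIPLE» theorems (`PlaquetteWalkHoleRootAnyTriple*`: hole five cells from the walls,
any three other removed cells leave both routes wound), and the two-cell pockets, written in box coordinates as EMPTINESS / `V ≡ 0`
theorems valid in EVERY box and for EVERY `S` containing the cells (no distance-to-the-wall hypothesis):

* ★★★★ `lawL_box_portTripleS_not_wound` / `…_vertexFunctional_eq_zero` — `pocketSW = (h.1 − 2, h.2 − 1)`, `farSWS = (h.1 − 1, h.2 − 2)`,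
  `holeS = (h.1, h.2 − 1)` removed ⇒ no wound class-`B2a` walk of either route, `V ≡ 0` on `[π/3, 2π/3]`; `…portTripleN…` (`pocketNW`,
  `farNWN`, `holeN`); `…portTripleW…` (`(h.1 − 3, h.2)`, `pocketSW`, `pocketNW`); ★★★★ `lawL_box_rootSealed_vertexFunctional_eq_zero` (`rootS`,
  `rootN`, `rootE = (h.1 + 2, h.2)` removed: no class-`B2a` walk at all);
* ★★★★ `lawL_box_pocketS2_not_wound` / `…_vertexFunctional_eq_zero` — `pocketSW`, `farSWS`, `holeSS = (h.1, h.2 − 2)`, `rootS = (h.1 + 1, h.2 − 1)`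
  removed (`holeS` may stay) ⇒ `V ≡ 0`; `…pocketN2…` the mirror.

Not in print; venture lane «pcv-sawmu», seat b-step0 gen 30 (the exception list of FINDING-YB-KILL-FORCED-ZEROS §28 add. 9, box form).

References: A. Glazman, Electron. Commun. Probab. 20 (2015) no. 86, Lemma 3.1, proof pp. 6–7 [Glazman2015WeightedSAW]; A. Glazman,
I. Manolescu, arXiv:1708.00395v3, §1 (Fig. 1), §2.1, Lemma 2.1 [GlazmanManolescu2019].
-/

noncomputable section

open Set Function Complex

namespace Literature.Barriers.CriticalPhenomena.PlaquetteWalk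

open Literature.Probability.RandomPlanarGeometry.SAW.YangBaxter
open Real Complex

section Boxes

variable {m n : ℕ} {S : List Face} {h : Face}

/-- ★★★★ **PORT TRIPLE OF `farS` REMOVED ⇒ NO WOUND WALK OF EITHER ROUTE**, every box, any further defects: `(h.1 − 2, h.2 − 1)`,
`(h.1 − 1, h.2 − 2)`, `(h.1, h.2 − 1)` in `S` (cells outside the box may be listed all the same).
[cite: Glazman2015WeightedSAW, Lemma 3.1 (proof, pp. 6–7)] [cite: GlazmanManolescu2019, Lemma 2.1 (statement, "in the form given in [Gl]"), §2.1] -/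
theorem lawL_box_portTripleS_not_wound (hW : 1 ≤ h.1) (hE : h.1 ≤ m) (hS0 : 0 ≤ h.2) (hN : h.2 + 1 ≤ n) (hh : h ∈ S)
    (hfS : ((h.1 - 1, h.2) : Face) ∉ S) (h1 : ((h.1 - 2, h.2 - 1) : Face) ∈ S) (h2 : ((h.1 - 1, h.2 - 2) : Face) ∈ S)
    (h3 : ((h.1, h.2 - 1) : Face) ∈ S)
    (ω : ΩG (dom (boxMinus m n S)) (Face.side (h.1 + 1, h.2) .W) (farW (h.1 + 1, h.2))) (hb : ω.IsB2a) (θ : ℝ) :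
    ω.WE (fun _ => θ) = excursionWinding θ ω.2.firstSideG
      (ω.z1 (rootedFace_hroot_boxMinus_of_mem (farW_hroot_mem_boxMinus_of_not_mem hW hE hS0 hN hfS) hh) hb) ω.1 := by
  refine ΩG.WE_eq_excursionWinding_of_farSW_deadEnd ?_ ?_ ?_ ?_ ω _ hb θ
  · rw [holeFaceW_hroot]; exact not_mem_dom_boxMinus_of_mem hh
  · have e : ((h.1 + 1 - 3, h.2 - 1) : Face) = (h.1 - 2, h.2 - 1) := Prod.ext (by simp only; ring) rfl
    rw [e]; exact not_mem_dom_boxMinus_of_mem h1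
  · have e : ((h.1 + 1 - 2, h.2 - 2) : Face) = (h.1 - 1, h.2 - 2) := Prod.ext (by simp only; ring) rfl
    rw [e]; exact not_mem_dom_boxMinus_of_mem h2
  · have e : ((h.1 + 1 - 1, h.2 - 1) : Face) = (h.1, h.2 - 1) := Prod.ext (by simp only; ring) rfl
    rw [e]; exact not_mem_dom_boxMinus_of_mem h3

/-- ★★★ **…hence `V ≡ 0`** (port triple of `farS`). [cite: GlazmanManolescu2019, Lemma 2.1 (statement, "in the form given in [Gl]"), §1 eq. (1), §2.1]
[cite: Glazman2015WeightedSAW, Lemma 3.1 (proof, pp. 6–7)] -/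
theorem lawL_box_portTripleS_vertexFunctional_eq_zero (hW : 1 ≤ h.1) (hE : h.1 ≤ m) (hS0 : 0 ≤ h.2) (hN : h.2 + 1 ≤ n)
    (hh : h ∈ S) (hfS : ((h.1 - 1, h.2) : Face) ∉ S) (h1 : ((h.1 - 2, h.2 - 1) : Face) ∈ S)
    (h2 : ((h.1 - 1, h.2 - 2) : Face) ∈ S) (h3 : ((h.1, h.2 - 1) : Face) ∈ S) {θ : ℝ} (hθ : θ ∈ Set.Icc (π / 3) (2 * π / 3)) :
    vertexFunctional (printedWeights θ) tFiveEighths (ybCoeff θ) (boxMinus m n S) (Face.side (h.1 + 1, h.2) .W)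
      (farW (h.1 + 1, h.2)) = 0 :=
  vertexFunctional_printed_eq_zero_of_both_unwound hθ (farW_hroot_mem_boxMinus_of_not_mem hW hE hS0 hN hfS)
    (by rw [holeFaceW_hroot]; exact not_mem_dom_boxMinus_of_mem hh) fun _ ω hb =>
    lawL_box_portTripleS_not_wound hW hE hS0 hN hh hfS h1 h2 h3 ω hb θ

/-- ★★★★ **PORT TRIPLE OF `farN` REMOVED ⇒ NO WOUND WALK OF EITHER ROUTE**: `(h.1 − 2, h.2 + 1)`, `(h.1 − 1, h.2 + 2)`, `(h.1, h.2 + 1)` in `S`.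
[cite: Glazman2015WeightedSAW, Lemma 3.1 (proof, pp. 6–7)] [cite: GlazmanManolescu2019, Lemma 2.1 (statement, "in the form given in [Gl]"), §2.1] -/
theorem lawL_box_portTripleN_not_wound (hW : 1 ≤ h.1) (hE : h.1 ≤ m) (hS0 : 0 ≤ h.2) (hN : h.2 + 1 ≤ n) (hh : h ∈ S)
    (hfS : ((h.1 - 1, h.2) : Face) ∉ S) (h1 : ((h.1 - 2, h.2 + 1) : Face) ∈ S) (h2 : ((h.1 - 1, h.2 + 2) : Face) ∈ S)
    (h3 : ((h.1, h.2 + 1) : Face) ∈ S)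
    (ω : ΩG (dom (boxMinus m n S)) (Face.side (h.1 + 1, h.2) .W) (farW (h.1 + 1, h.2))) (hb : ω.IsB2a) (θ : ℝ) :
    ω.WE (fun _ => θ) = excursionWinding θ ω.2.firstSideG
      (ω.z1 (rootedFace_hroot_boxMinus_of_mem (farW_hroot_mem_boxMinus_of_not_mem hW hE hS0 hN hfS) hh) hb) ω.1 := by
  refine ΩG.WE_eq_excursionWinding_of_farNW_deadEnd ?_ ?_ ?_ ?_ ω _ hb θ
  · rw [holeFaceW_hroot]; exact not_mem_dom_boxMinus_of_mem hh
  · have e : ((h.1 + 1 - 3, h.2 + 1) : Face) = (h.1 - 2, h.2 + 1) := Prod.ext (by simp only; ring) rfl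
    rw [e]; exact not_mem_dom_boxMinus_of_mem h1
  · have e : ((h.1 + 1 - 2, h.2 + 2) : Face) = (h.1 - 1, h.2 + 2) := Prod.ext (by simp only; ring) rfl
    rw [e]; exact not_mem_dom_boxMinus_of_mem h2
  · have e : ((h.1 + 1 - 1, h.2 + 1) : Face) = (h.1, h.2 + 1) := Prod.ext (by simp only; ring) rfl
    rw [e]; exact not_mem_dom_boxMinus_of_mem h3

/-- ★★★ **…hence `V ≡ 0`** (port triple of `farN`). [cite: GlazmanManolescu2019, Lemma 2.1 (statement, "in the form given in [Gl]"), §1 eq. (1), §2.1]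
[cite: Glazman2015WeightedSAW, Lemma 3.1 (proof, pp. 6–7)] -/
theorem lawL_box_portTripleN_vertexFunctional_eq_zero (hW : 1 ≤ h.1) (hE : h.1 ≤ m) (hS0 : 0 ≤ h.2) (hN : h.2 + 1 ≤ n)
    (hh : h ∈ S) (hfS : ((h.1 - 1, h.2) : Face) ∉ S) (h1 : ((h.1 - 2, h.2 + 1) : Face) ∈ S)
    (h2 : ((h.1 - 1, h.2 + 2) : Face) ∈ S) (h3 : ((h.1, h.2 + 1) : Face) ∈ S) {θ : ℝ} (hθ : θ ∈ Set.Icc (π / 3) (2 * π / 3)) :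
    vertexFunctional (printedWeights θ) tFiveEighths (ybCoeff θ) (boxMinus m n S) (Face.side (h.1 + 1, h.2) .W)
      (farW (h.1 + 1, h.2)) = 0 :=
  vertexFunctional_printed_eq_zero_of_both_unwound hθ (farW_hroot_mem_boxMinus_of_not_mem hW hE hS0 hN hfS)
    (by rw [holeFaceW_hroot]; exact not_mem_dom_boxMinus_of_mem hh) fun _ ω hb =>
    lawL_box_portTripleN_not_wound hW hE hS0 hN hh hfS h1 h2 h3 ω hb θ

/-- ★★★★ **PORT TRIPLE OF `farWW` REMOVED ⇒ NO WOUND WALK OF EITHER ROUTE**: `(h.1 − 3, h.2)`, `(h.1 − 2, h.2 − 1)`, `(h.1 − 2, h.2 + 1)` in `S`.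
[cite: Glazman2015WeightedSAW, Lemma 3.1 (proof, pp. 6–7)] [cite: GlazmanManolescu2019, Lemma 2.1 (statement, "in the form given in [Gl]"), §2.1] -/
theorem lawL_box_portTripleW_not_wound (hW : 1 ≤ h.1) (hE : h.1 ≤ m) (hS0 : 0 ≤ h.2) (hN : h.2 + 1 ≤ n) (hh : h ∈ S)
    (hfS : ((h.1 - 1, h.2) : Face) ∉ S) (h1 : ((h.1 - 3, h.2) : Face) ∈ S) (h2 : ((h.1 - 2, h.2 - 1) : Face) ∈ S)
    (h3 : ((h.1 - 2, h.2 + 1) : Face) ∈ S)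
    (ω : ΩG (dom (boxMinus m n S)) (Face.side (h.1 + 1, h.2) .W) (farW (h.1 + 1, h.2))) (hb : ω.IsB2a) (θ : ℝ) :
    ω.WE (fun _ => θ) = excursionWinding θ ω.2.firstSideG
      (ω.z1 (rootedFace_hroot_boxMinus_of_mem (farW_hroot_mem_boxMinus_of_not_mem hW hE hS0 hN hfS) hh) hb) ω.1 := by
  refine ΩG.WE_eq_excursionWinding_of_farWW_deadEnd ?_ ?_ ?_ ?_ ω _ hb θ
  · rw [holeFaceW_hroot]; exact not_mem_dom_boxMinus_of_mem hh
  · have e : ((h.1 + 1 - 4, h.2) : Face) = (h.1 - 3, h.2) := Prod.ext (by simp only; ring) rfl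
    rw [e]; exact not_mem_dom_boxMinus_of_mem h1
  · have e : ((h.1 + 1 - 3, h.2 - 1) : Face) = (h.1 - 2, h.2 - 1) := Prod.ext (by simp only; ring) rfl
    rw [e]; exact not_mem_dom_boxMinus_of_mem h2
  · have e : ((h.1 + 1 - 3, h.2 + 1) : Face) = (h.1 - 2, h.2 + 1) := Prod.ext (by simp only; ring) rfl
    rw [e]; exact not_mem_dom_boxMinus_of_mem h3

/-- ★★★ **…hence `V ≡ 0`** (port triple of `farWW`). [cite: GlazmanManolescu2019, Lemma 2.1 (statement, "in the form given in [Gl]"), §1 eq. (1), §2.1]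
[cite: Glazman2015WeightedSAW, Lemma 3.1 (proof, pp. 6–7)] -/
theorem lawL_box_portTripleW_vertexFunctional_eq_zero (hW : 1 ≤ h.1) (hE : h.1 ≤ m) (hS0 : 0 ≤ h.2) (hN : h.2 + 1 ≤ n)
    (hh : h ∈ S) (hfS : ((h.1 - 1, h.2) : Face) ∉ S) (h1 : ((h.1 - 3, h.2) : Face) ∈ S) (h2 : ((h.1 - 2, h.2 - 1) : Face) ∈ S)
    (h3 : ((h.1 - 2, h.2 + 1) : Face) ∈ S) {θ : ℝ} (hθ : θ ∈ Set.Icc (π / 3) (2 * π / 3)) :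
    vertexFunctional (printedWeights θ) tFiveEighths (ybCoeff θ) (boxMinus m n S) (Face.side (h.1 + 1, h.2) .W)
      (farW (h.1 + 1, h.2)) = 0 :=
  vertexFunctional_printed_eq_zero_of_both_unwound hθ (farW_hroot_mem_boxMinus_of_not_mem hW hE hS0 hN hfS)
    (by rw [holeFaceW_hroot]; exact not_mem_dom_boxMinus_of_mem hh) fun _ ω hb =>
    lawL_box_portTripleW_not_wound hW hE hS0 hN hh hfS h1 h2 h3 ω hb θ

/-- ★★★★ **ROOT PLAQUETTE SEALED (`rootS = (h.1 + 1, h.2 − 1)`, `rootN = (h.1 + 1, h.2 + 1)`, `rootE = (h.1 + 2, h.2)` REMOVED) ⇒ `V ≡ 0`**, every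
box: no class-`B2a` walk at the far cell exists. [cite: GlazmanManolescu2019, Lemma 2.1 (statement, "in the form given in [Gl]"), §1 eq. (1), §2.1]
[cite: Glazman2015WeightedSAW, Lemma 3.1 (proof, pp. 6–7)] -/
theorem lawL_box_rootSealed_vertexFunctional_eq_zero (hW : 1 ≤ h.1) (hE : h.1 ≤ m) (hS0 : 0 ≤ h.2) (hN : h.2 + 1 ≤ n)
    (hh : h ∈ S) (hfS : ((h.1 - 1, h.2) : Face) ∉ S) (h1 : ((h.1 + 1, h.2 - 1) : Face) ∈ S)
    (h2 : ((h.1 + 1, h.2 + 1) : Face) ∈ S) (h3 : ((h.1 + 2, h.2) : Face) ∈ S) {θ : ℝ} (hθ : θ ∈ Set.Icc (π / 3) (2 * π / 3)) :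
    vertexFunctional (printedWeights θ) tFiveEighths (ybCoeff θ) (boxMinus m n S) (Face.side (h.1 + 1, h.2) .W)
      (farW (h.1 + 1, h.2)) = 0 := by
  refine vertexFunctional_printed_eq_zero_of_both_unwound hθ (farW_hroot_mem_boxMinus_of_not_mem hW hE hS0 hN hfS)
    (by rw [holeFaceW_hroot]; exact not_mem_dom_boxMinus_of_mem hh) fun _ ω hb => ?_
  refine (ΩG.false_of_rootSealed ?_ ?_ ?_ ?_ ω hb).elim
  · rw [holeFaceW_hroot]; exact not_mem_dom_boxMinus_of_mem hh
  · have e : rootS ((h.1 + 1, h.2) : Face) = (h.1 + 1, h.2 - 1) := Prod.ext (by simp only [rootS]) rfl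
    rw [e]; exact not_mem_dom_boxMinus_of_mem h1
  · have e : rootN ((h.1 + 1, h.2) : Face) = (h.1 + 1, h.2 + 1) := Prod.ext (by simp only [rootN]) rfl
    rw [e]; exact not_mem_dom_boxMinus_of_mem h2
  · have e : ((h.1 + 1 + 1, h.2) : Face) = (h.1 + 2, h.2) := Prod.ext (by simp only; ring) rfl
    rw [e]; exact not_mem_dom_boxMinus_of_mem h3

/-- ★★★★ **THE SEALED POCKET BELOW (`(h.1 − 2, h.2 − 1)`, `(h.1 − 1, h.2 − 2)`, `(h.1, h.2 − 2)`, `(h.1 + 1, h.2 − 1)` REMOVED; `holeS` may stay) ⇒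
NO WOUND WALK OF EITHER ROUTE**, every box. [cite: Glazman2015WeightedSAW, Lemma 3.1 (proof, pp. 6–7)]
[cite: GlazmanManolescu2019, Lemma 2.1 (statement, "in the form given in [Gl]"), §2.1] -/
theorem lawL_box_pocketS2_not_wound (hW : 1 ≤ h.1) (hE : h.1 ≤ m) (hS0 : 0 ≤ h.2) (hN : h.2 + 1 ≤ n) (hh : h ∈ S)
    (hfS : ((h.1 - 1, h.2) : Face) ∉ S) (h1 : ((h.1 - 2, h.2 - 1) : Face) ∈ S) (h2 : ((h.1 - 1, h.2 - 2) : Face) ∈ S)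
    (h3 : ((h.1, h.2 - 2) : Face) ∈ S) (h4 : ((h.1 + 1, h.2 - 1) : Face) ∈ S)
    (ω : ΩG (dom (boxMinus m n S)) (Face.side (h.1 + 1, h.2) .W) (farW (h.1 + 1, h.2))) (hb : ω.IsB2a) (θ : ℝ) :
    ω.WE (fun _ => θ) = excursionWinding θ ω.2.firstSideG
      (ω.z1 (rootedFace_hroot_boxMinus_of_mem (farW_hroot_mem_boxMinus_of_not_mem hW hE hS0 hN hfS) hh) hb) ω.1 := by
  refine ΩG.WE_eq_excursionWinding_of_farSW_pocket2 ?_ ?_ ?_ ?_ ?_ ω _ hb θ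
  · rw [holeFaceW_hroot]; exact not_mem_dom_boxMinus_of_mem hh
  · have e : ((h.1 + 1 - 3, h.2 - 1) : Face) = (h.1 - 2, h.2 - 1) := Prod.ext (by simp only; ring) rfl
    rw [e]; exact not_mem_dom_boxMinus_of_mem h1
  · have e : ((h.1 + 1 - 2, h.2 - 2) : Face) = (h.1 - 1, h.2 - 2) := Prod.ext (by simp only; ring) rfl
    rw [e]; exact not_mem_dom_boxMinus_of_mem h2
  · have e : ((h.1 + 1 - 1, h.2 - 2) : Face) = (h.1, h.2 - 2) := Prod.ext (by simp only; ring) rfl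
    rw [e]; exact not_mem_dom_boxMinus_of_mem h3
  · have e : rootS ((h.1 + 1, h.2) : Face) = (h.1 + 1, h.2 - 1) := Prod.ext (by simp only [rootS]) rfl
    rw [e]; exact not_mem_dom_boxMinus_of_mem h4

/-- ★★★ **…hence `V ≡ 0`** (sealed pocket below). [cite: GlazmanManolescu2019, Lemma 2.1 (statement, "in the form given in [Gl]"), §1 eq. (1), §2.1]
[cite: Glazman2015WeightedSAW, Lemma 3.1 (proof, pp. 6–7)] -/
theorem lawL_box_pocketS2_vertexFunctional_eq_zero (hW : 1 ≤ h.1) (hE : h.1 ≤ m) (hS0 : 0 ≤ h.2) (hN : h.2 + 1 ≤ n)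
    (hh : h ∈ S) (hfS : ((h.1 - 1, h.2) : Face) ∉ S) (h1 : ((h.1 - 2, h.2 - 1) : Face) ∈ S) (h2 : ((h.1 - 1, h.2 - 2) : Face) ∈ S)
    (h3 : ((h.1, h.2 - 2) : Face) ∈ S) (h4 : ((h.1 + 1, h.2 - 1) : Face) ∈ S) {θ : ℝ} (hθ : θ ∈ Set.Icc (π / 3) (2 * π / 3)) :
    vertexFunctional (printedWeights θ) tFiveEighths (ybCoeff θ) (boxMinus m n S) (Face.side (h.1 + 1, h.2) .W)
      (farW (h.1 + 1, h.2)) = 0 :=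
  vertexFunctional_printed_eq_zero_of_both_unwound hθ (farW_hroot_mem_boxMinus_of_not_mem hW hE hS0 hN hfS)
    (by rw [holeFaceW_hroot]; exact not_mem_dom_boxMinus_of_mem hh) fun _ ω hb =>
    lawL_box_pocketS2_not_wound hW hE hS0 hN hh hfS h1 h2 h3 h4 ω hb θ

/-- ★★★★ **THE SEALED POCKET ABOVE (`(h.1 − 2, h.2 + 1)`, `(h.1 − 1, h.2 + 2)`, `(h.1, h.2 + 2)`, `(h.1 + 1, h.2 + 1)` REMOVED) ⇒ NO WOUND WALK
OF EITHER ROUTE**, every box. [cite: Glazman2015WeightedSAW, Lemma 3.1 (proof, pp. 6–7)]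
[cite: GlazmanManolescu2019, Lemma 2.1 (statement, "in the form given in [Gl]"), §2.1, §4.2] -/
theorem lawL_box_pocketN2_not_wound (hW : 1 ≤ h.1) (hE : h.1 ≤ m) (hS0 : 0 ≤ h.2) (hN : h.2 + 1 ≤ n) (hh : h ∈ S)
    (hfS : ((h.1 - 1, h.2) : Face) ∉ S) (h1 : ((h.1 - 2, h.2 + 1) : Face) ∈ S) (h2 : ((h.1 - 1, h.2 + 2) : Face) ∈ S)
    (h3 : ((h.1, h.2 + 2) : Face) ∈ S) (h4 : ((h.1 + 1, h.2 + 1) : Face) ∈ S)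
    (ω : ΩG (dom (boxMinus m n S)) (Face.side (h.1 + 1, h.2) .W) (farW (h.1 + 1, h.2))) (hb : ω.IsB2a) (θ : ℝ) :
    ω.WE (fun _ => θ) = excursionWinding θ ω.2.firstSideG
      (ω.z1 (rootedFace_hroot_boxMinus_of_mem (farW_hroot_mem_boxMinus_of_not_mem hW hE hS0 hN hfS) hh) hb) ω.1 := by
  refine ΩG.WE_eq_excursionWinding_of_farNW_pocket2 ?_ ?_ ?_ ?_ ?_ ω _ hb θ
  · rw [holeFaceW_hroot]; exact not_mem_dom_boxMinus_of_mem hh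
  · have e : ((h.1 + 1 - 3, h.2 + 1) : Face) = (h.1 - 2, h.2 + 1) := Prod.ext (by simp only; ring) rfl
    rw [e]; exact not_mem_dom_boxMinus_of_mem h1
  · have e : ((h.1 + 1 - 2, h.2 + 2) : Face) = (h.1 - 1, h.2 + 2) := Prod.ext (by simp only; ring) rfl
    rw [e]; exact not_mem_dom_boxMinus_of_mem h2
  · have e : ((h.1 + 1 - 1, h.2 + 2) : Face) = (h.1, h.2 + 2) := Prod.ext (by simp only; ring) rfl
    rw [e]; exact not_mem_dom_boxMinus_of_mem h3
  · have e : rootN ((h.1 + 1, h.2) : Face) = (h.1 + 1, h.2 + 1) := Prod.ext (by simp only [rootN]) rfl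
    rw [e]; exact not_mem_dom_boxMinus_of_mem h4

/-- ★★★ **…hence `V ≡ 0`** (sealed pocket above). [cite: GlazmanManolescu2019, Lemma 2.1 (statement, "in the form given in [Gl]"), §1 eq. (1), §2.1]
[cite: Glazman2015WeightedSAW, Lemma 3.1 (proof, pp. 6–7)] -/
theorem lawL_box_pocketN2_vertexFunctional_eq_zero (hW : 1 ≤ h.1) (hE : h.1 ≤ m) (hS0 : 0 ≤ h.2) (hN : h.2 + 1 ≤ n)
    (hh : h ∈ S) (hfS : ((h.1 - 1, h.2) : Face) ∉ S) (h1 : ((h.1 - 2, h.2 + 1) : Face) ∈ S) (h2 : ((h.1 - 1, h.2 + 2) : Face) ∈ S)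
    (h3 : ((h.1, h.2 + 2) : Face) ∈ S) (h4 : ((h.1 + 1, h.2 + 1) : Face) ∈ S) {θ : ℝ} (hθ : θ ∈ Set.Icc (π / 3) (2 * π / 3)) :
    vertexFunctional (printedWeights θ) tFiveEighths (ybCoeff θ) (boxMinus m n S) (Face.side (h.1 + 1, h.2) .W)
      (farW (h.1 + 1, h.2)) = 0 :=
  vertexFunctional_printed_eq_zero_of_both_unwound hθ (farW_hroot_mem_boxMinus_of_not_mem hW hE hS0 hN hfS)
    (by rw [holeFaceW_hroot]; exact not_mem_dom_boxMinus_of_mem hh) fun _ ω hb =>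
    lawL_box_pocketN2_not_wound hW hE hS0 hN hh hfS h1 h2 h3 h4 ω hb θ

end Boxes

end Literature.Barriers.CriticalPhenomena.PlaquetteWalk
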